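import Mathlib
import HarnessLib
import Summits.HubbardSuperconductivity.HubbardSuperconductivity.Theorems.KLProgrammeFermiSurfaceExtWindow
import Summits.HubbardSuperconductivity.HubbardSuperconductivity.Theorems.KLProgrammeFermiSurfaceExtWindowSharp
import Summits.HubbardSuperconductivity.HubbardSuperconductivity.Theorems.KLProgrammeFermiSurfaceDopingWindowSharp

/-!
# Route `KLProgramme` / `WeakCouplingBCS` — risk-register item r2: the Fermi-surface rows on the CERTIFICATE'S form-(A) window
# `μ ∈ [-0.5725, -0.1775]` (`δ ∈ [0.10, 0.25]`: cert-2's WinZ `[-0.5725, -0.42749]` ∪ margin-2's WinA–C `[-0.42749, -0.1775]`)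

Cell `gate-hubbard-kl`, seat fs-1 (g7). Since cert-3's `WeakCouplingBCSWcbcsKohnLuttingerB1gFormAWindowD010D025.lean` the
certificate half of R2d is read, in form (A), on the doping window `δ ∈ [0.10, 0.25]`, with the UNCONDITIONAL link
`muOfDoping_mem_window_d010_d025 : δ ∈ [0.10, 0.25] ⇒ μ(δ) ∈ [-0.5725, -0.1775]`. This file is the `[-0.5725, -0.1775]` edition
of `KLProgrammeFermiSurfaceDopingWindow.lean` / `…DopingWindowSharp.lean` (the numeric rows), so that the `δ ∈ [0.10, 0.25]` form is a
one-line composition (companion `KLProgrammeFermiSurfaceCertDopingForm.lean`). FINDING: every row whose binding end is the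
low-doping end `μ = -0.1775` keeps the constant of the window of record `[-0.4275, -0.1775]` — `v_F ≥ 0.8237`, `0.0313 ≤ κ ≤ 2.43`,
nesting defect `≥ 0.355`, corner transversality `≥ 0.1018`, `∂ₜF ≥ 0.8236`, `r₀, g₀, w_min`, `s_* = 0.4118`, `A2 ≤ 33.2`,
`smax ≤ 3.85` —; only the left-end quantities move (`|e|₂ ≤ 4.5725`, `umin ≥ 2.018`, `cmax ≤ 0.694`, `hmin ≥ 0.183`, `amin ≥ 0.0633`,
hence `C_g ≤ 102` instead of `98`). The qualitative rows (FST II (A1)–(A4)/(Sy)/(A3) global, `¬(A5)` + quadruple + corner, the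
excluding/admitting classes, FST II Thm 1.1) hold by inclusion in the extended window `[-0.5725, -0.075]` (`klfs_cwin_xwin`,
`KLProgrammeFermiSurfaceExtWindow.lean`) and are not restated.

Rows (every `μ ∈ [-0.5725, -0.1775]`; certified values kit j258297 = the j247824/j252652 scripts of record with level grids
replaced, two interval implementations, FS-WINDOW.md §10):
* §1 `v_F = ‖∇ε‖ ≥ 0.8237` (true `0.82371`), `∇ε ≠ 0`, `0.0313 ≤ κ ≤ 2.43` (true `0.031409 … 2.4281`), nesting defect `≥ 0.355`,
  corner transversality factor `m·s ≥ 0.1018` (true `0.10238`; proved from `m²(4-m²)` monotone, not termwise);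
* §2 FST II `GeomConstants e 4.5725 0.0887 0.575 0.0443`; FST III `Admits M ⟨0, 42, normV, 0.574, 0.0887, 0.0443⟩` + (H1)–(H4),
  `¬(H5)`; BGM 2003 `DispersionHyp` / `LatticeModelHyp` / Lemma 3.1 with the window-of-record shell `e₀ = 0.08`;
* §3 `∂ₜF ≥ 0.8236` (`= 2 s_b`, exact) and the SHARP `BandBounds (-0.5725) (-0.1775)` bundle with Lean numbers: `umin ≥ 2.018`,
  `smax ≤ 3.85`, `A2 ≤ 33.2`, `hmin ≥ 0.183`, `amin ≥ 0.0633`, `rhomin ≥ 0.4118`, `cmax ≤ 0.694`, `Dtmin ≥ 0.8236`, `C_g ≤ 102`,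
  `Dcell ≤ 3.14`.

No definitions; everything PROVED (compositions of the lineage's closed forms with rational arithmetic; the transcendental inputs
`d_a = arccos 0.143125 ∈ [1.427, 1.5708]`, `sinc d_a ≤ 0.694` are `…ExtWindowSharp.lean`'s, `K_b = arccos(-0.91125) ≤ 2.72`,
`κ_b ≥ 0.0314` are `…DopingWindowSharp.lean`'s). [folklore]
-/
noncomputable section

open Real Set

-- the tree's namespace `Summit.<Summit>.<Problem>.Theorems` repeats the summit name by design (D-0017)
set_option linter.dupNamespace false

namespace Summit.HubbardSuperconductivity.HubbardSuperconductivity.Theorems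

open Literature.MathematicalPhysics.QuantumLattice
open Literature.MathematicalPhysics.QuantumLattice.BandSectorCounting

/-! ### §0 The window -/

/-- The certificate's form-(A) window `μ ∈ [-0.5725, -0.1775]` lies in `(-2, 0)`. [folklore] -/
theorem klfs_cwin_sub {μ : ℝ} (hμ : μ ∈ Icc (-0.5725 : ℝ) (-0.1775)) : -2 < μ ∧ μ < 0 :=
  ⟨by linarith [hμ.1], by linarith [hμ.2]⟩

/-- `[-0.5725, -0.1775]` is a sub-window of the extended window `[-0.5725, -0.075]` (so every `klfs_xwin_*` row applies) and of
the analysis window `[-1, -0.15]` of K1/K3. [folklore] -/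
theorem klfs_cwin_xwin {μ : ℝ} (hμ : μ ∈ Icc (-0.5725 : ℝ) (-0.1775)) :
    μ ∈ Icc (-0.5725 : ℝ) (-0.075) ∧ μ ∈ Icc (-1 : ℝ) (-0.15) :=
  ⟨⟨hμ.1, by linarith [hμ.2]⟩, ⟨by linarith [hμ.1], by linarith [hμ.2]⟩⟩

/-- The doping window of record `[-0.4275, -0.1775]`, margin-2's `[-0.42749, -0.1775]` and cert-2's WinZ `[-0.5725, -0.42749]`
all lie in `[-0.5725, -0.1775]`. [folklore] -/
theorem klfs_cwin_of_sub {μ : ℝ}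
    (hμ : μ ∈ Icc (-0.4275 : ℝ) (-0.1775) ∨ μ ∈ Icc (-0.42749 : ℝ) (-0.1775) ∨ μ ∈ Icc (-0.5725 : ℝ) (-0.42749)) :
    μ ∈ Icc (-0.5725 : ℝ) (-0.1775) := by
  rcases hμ with h | h | h
  · exact ⟨by linarith [h.1], h.2⟩
  · exact ⟨by linarith [h.1], h.2⟩
  · exact ⟨h.1, by linarith [h.2]⟩

/-! ### §1 Speed, curvature, nesting, corner transversality (binding end `μ = -0.1775`: constants of the window of record) -/

/-- **`v_F ≥ 0.8237` on `[-0.5725, -0.1775]`**: at any point of the level curve `-2(cos x + cos y) = μ`,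
`2 √(sin² x + sin² y) ≥ 0.8237` (true minimum `√(0.1775 · 3.8225) = 0.82371` at the antinode of `μ = -0.1775`). [folklore] -/
theorem klfs_cwin_fermiSpeed_ge {μ x y : ℝ} (hμ : μ ∈ Icc (-0.5725 : ℝ) (-0.1775))
    (h : -2 * (Real.cos x + Real.cos y) = μ) : 0.8237 ≤ 2 * Real.sqrt (Real.sin x ^ 2 + Real.sin y ^ 2) := by
  have hI := (klfs_fermiSpeedSq_mem_Icc h).1
  have hμ2 : (0.8237 : ℝ) ^ 2 ≤ -μ * (4 + μ) := by
    nlinarith [mul_nonpos_iff.2 (Or.inl ⟨sub_nonneg.2 hμ.1, sub_nonpos.2 hμ.2⟩), hμ.1, hμ.2]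
  rw [klfs_two_mul_sqrt]
  exact Real.le_sqrt_of_sq_le (hμ2.trans hI)

/-- The same in `KohnLuttinger` vocabulary: `‖∇ε(k)‖ ≥ 0.8237` on the Fermi curve, `μ ∈ [-0.5725, -0.1775]`. [folklore] -/
theorem klfs_cwin_norm_gradient_ge {μ : ℝ} (hμ : μ ∈ Icc (-0.5725 : ℝ) (-0.1775)) {k : Momentum}
    (hk : k ∈ fermiCurve (squareDispersion 1 0) μ) : 0.8237 ≤ ‖gradient (squareDispersion 1 0) k‖ := by
  have he : -2 * (Real.cos (k 0) + Real.cos (k 1)) = μ := by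
    have := hk.2; simp [squareDispersion] at this; linarith
  rw [norm_gradient_squareDispersion]
  exact klfs_cwin_fermiSpeed_ge hμ he

/-- `∇ε ≠ 0` on the Fermi curve, `μ ∈ [-0.5725, -0.1775]` (FST II (A2)). [folklore] -/
theorem klfs_cwin_gradient_ne_zero {μ : ℝ} (hμ : μ ∈ Icc (-0.5725 : ℝ) (-0.1775)) {k : Momentum}
    (hk : k ∈ fermiCurve (squareDispersion 1 0) μ) : gradient (squareDispersion 1 0) k ≠ 0 :=
  klfs_gradient_ne_zero (by linarith [hμ.1]) (by linarith [hμ.2]) hk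

/-- **`0.0313 ≤ κ ≤ 2.43` on `[-0.5725, -0.1775]`** (true extremes `0.031409` at the node of `μ = -0.1775` and `2.4281` at its
antinode — the curvature envelope of the window of record is unchanged). [folklore] -/
theorem klfs_cwin_curvature {μ x y : ℝ} (hμ : μ ∈ Icc (-0.5725 : ℝ) (-0.1775))
    (h : -2 * (Real.cos x + Real.cos y) = μ) :
    (Real.cos x * Real.sin y ^ 2 + Real.cos y * Real.sin x ^ 2) /
        ((Real.sin x ^ 2 + Real.sin y ^ 2) * Real.sqrt (Real.sin x ^ 2 + Real.sin y ^ 2)) ∈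
      Icc (0.0313 : ℝ) 2.43 := by
  obtain ⟨hμ₁, hμ₂⟩ := klfs_cwin_sub hμ
  have hI := klfs_curvature_mem_Icc (by linarith) hμ₂ h
  constructor
  · refine le_trans ?_ hI.1
    have hs : Real.sqrt (32 - 2 * μ ^ 2) ≤ 5.66 := by
      rw [Real.sqrt_le_left (by norm_num)]; nlinarith
    have hspos : 0 < Real.sqrt (32 - 2 * μ ^ 2) := Real.sqrt_pos.2 (by nlinarith)
    rw [le_div_iff₀ hspos]
    nlinarith [hμ.2]
  · refine le_trans hI.2 ?_
    have hs : (0.8237 : ℝ) ≤ Real.sqrt (-μ * (4 + μ)) := by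
      apply Real.le_sqrt_of_sq_le
      nlinarith [mul_nonpos_iff.2 (Or.inl ⟨sub_nonneg.2 hμ.1, sub_nonpos.2 hμ.2⟩), hμ.1, hμ.2]
    rw [div_le_iff₀ (by linarith)]
    nlinarith

/-- **Nesting defect `≥ 0.355` on `[-0.5725, -0.1775]`** (`|ε(k + (π,π)) - μ| = 2|μ|`). [folklore] -/
theorem klfs_cwin_nesting_defect {μ : ℝ} (hμ : μ ∈ Icc (-0.5725 : ℝ) (-0.1775)) {k : Fin 2 → ℝ}
    (hk : sqDispersion k = μ) : 0.355 ≤ |sqDispersion (fun i => k i + π) - μ| := by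
  rw [klfs_nesting_defect hk, abs_of_neg (by linarith [hμ.2])]
  linarith [hμ.2]

/-- **Quantitative corner transversality on `[-0.5725, -0.1775]`**: at the `(1,0)`-corner, `sin²x₁ - sin²y₁ = m·s ≥ 0.1018`
(`m = -μ/2 ∈ [0.08875, 0.28625]`, `s = √((4 - m²)/3)`; `(m s)² = m²(4 - m²)/3` is increasing in `m²`, so the minimum `0.10238` is
at `μ = -0.1775` — the same as on the window of record; a termwise bound would only give `0.1014`). [folklore] -/
theorem klfs_cwin_corner_transversality_factor_ge {μ : ℝ} (hμ : μ ∈ Icc (-0.5725 : ℝ) (-0.1775)) {θ : ℝ}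
    (hθ : θ ∈ Ioo (0 : ℝ) (π / 4)) (hcorner : rayDispersion (θ, 3 * bandFermiRadius μ θ) = μ) :
    (0.1018 : ℝ) ≤ Real.sin (bandX μ θ) ^ 2 - Real.sin (bandY μ θ) ^ 2 := by
  obtain ⟨hμ₁, hμ₂⟩ := klfs_cwin_sub hμ
  rw [klfs_corner_transversality_factor (by linarith) hμ₂ hθ hcorner]
  set m : ℝ := -μ / 2 with hm_def
  have hm : (0.08875 : ℝ) ≤ m := by rw [hm_def]; linarith [hμ.2]
  have hm1 : m ≤ (0.28625 : ℝ) := by rw [hm_def]; linarith [hμ.1]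
  have hm0 : (0 : ℝ) ≤ m := by linarith
  have hrad : (0 : ℝ) ≤ (4 - m ^ 2) / 3 := by nlinarith
  have hs0 : (0 : ℝ) ≤ Real.sqrt ((4 - m ^ 2) / 3) := Real.sqrt_nonneg _
  have hs2 : Real.sqrt ((4 - m ^ 2) / 3) ^ 2 = (4 - m ^ 2) / 3 := Real.sq_sqrt hrad
  have h1 : (0.08875 : ℝ) ^ 2 ≤ m ^ 2 := pow_le_pow_left₀ (by norm_num) hm 2
  have h2 : m ^ 2 ≤ (0.28625 : ℝ) ^ 2 := pow_le_pow_left₀ hm0 hm1 2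
  have key : (0.1018 : ℝ) ^ 2 ≤ (m * Real.sqrt ((4 - m ^ 2) / 3)) ^ 2 := by
    rw [mul_pow, hs2]
    nlinarith [mul_nonneg (sub_nonneg.2 h1) (show (0 : ℝ) ≤ 4 - m ^ 2 - 0.08875 ^ 2 by nlinarith)]
  exact (sq_le_sq₀ (by norm_num) (mul_nonneg hm0 hs0)).1 key

/-! ### §2 The typed hypothesis sets with constants -/

/-- **FST II constants on `[-0.5725, -0.1775]`**: `|e|₂ ≤ 4.5725`, and on `{|e| < 0.0887}`: `|∇e| ≥ 0.575`,
`(t, e'' t) ≥ 0.0443 |t|²` — `GeomConstants e 4.5725 0.0887 0.575 0.0443` (closed form `(4+|μ|, -μ/2, √((-μ/2)(4+3μ/2)), -μ/4)`;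
the last three at the binding end `μ = -0.1775`: `0.08875, 0.57565, 0.044375`, as on the window of record). [folklore] -/
theorem klfs_cwin_geomConstants {μ : ℝ} (hμ : μ ∈ Icc (-0.5725 : ℝ) (-0.1775)) :
    FermiRG.GeomConstants (fun q : Momentum => squareDispersion 1 0 q - μ) 4.5725 0.0887 0.575 0.0443 where
  r₀_pos := by norm_num
  g₀_pos := by norm_num
  wmin_pos := by norm_num
  norm_iteratedFDeriv_le := fun p j hj => (klfs_norm_iteratedFDeriv_e_le μ p j hj).trans (by
    rw [abs_of_neg (by linarith [hμ.2])]; linarith [hμ.1])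
  le_norm_gradient := fun p hp => by
    have hμ₁ : -8 / 3 < μ := by linarith [hμ.1]
    have hμ₂ : μ < 0 := by linarith [hμ.2]
    have hp' : |squareDispersion 1 0 p - μ| < -μ / 2 := hp.trans_le (by linarith [hμ.2])
    refine le_trans ?_ (klfs_norm_gradient_ge_near hμ₁ hμ₂ hp')
    apply Real.le_sqrt_of_sq_le
    nlinarith [hμ.1, hμ.2]
  le_hessQuad := fun p hp t ht => by
    have hμ₁ : -8 / 3 < μ := by linarith [hμ.1]
    have hμ₂ : μ < 0 := by linarith [hμ.2]
    have hp' : |squareDispersion 1 0 p - μ| < -μ / 2 := hp.trans_le (by linarith [hμ.2])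
    refine le_trans ?_ (klfs_hessQuad_ge_near hμ₁ hμ₂ hp' ht)
    exact mul_le_mul_of_nonneg_right (by linarith [hμ.2]) (sq_nonneg _)

/-- **FST III on `[-0.5725, -0.1775]`**: ONE regularity datum `Admits M ⟨0, 42, normV, 0.574, 0.0887, 0.0443⟩` for any record
carrying the band and `v̂ ≡ U`, `|U| ≤ normV`; the hypotheses (H1)_{2,0}, (H2)_{2,0}, (H3), (H4) of Theorem 1.2 hold; the
filling clause (H5) of Theorem 1.1 (i) FAILS on the crystal's cell. [folklore] -/
theorem klfs_cwin_fst3 {μ : ℝ} (hμ : μ ∈ Icc (-0.5725 : ℝ) (-0.1775)) (M : FermiRG.FST3.Model 2)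
    (he : M.e = fun p : Momentum => squareDispersion 1 0 p - μ) {U : ℝ} (hv : M.vhat = fun _ => (U : ℂ))
    {normV : ℝ} (hV : |U| ≤ normV) :
    FermiRG.FST3.Admits M ⟨0, 42, normV, 0.574, 0.0887, 0.0443⟩ ∧
    (FermiRG.FST3.H1 2 0 M ∧ FermiRG.FST3.H2 2 0 M ∧ FermiRG.FST3.H3 M ∧ FermiRG.FST3.H4 M) ∧
    (M.fund = (FermiRG.Crystal.cubic 2).fundamentalDomain → ¬ FermiRG.FST3.H5 M) := by
  obtain ⟨hμ₁, hμ₂⟩ := klfs_cwin_sub hμ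
  have hG := klfs_cwin_geomConstants hμ
  refine ⟨⟨?_, ?_, by norm_num, by norm_num, by norm_num, fun p hp => ?_, fun p hp t ht => ?_⟩,
    klfs_fst3_theorem12_hypotheses (by linarith) hμ₂ M he hv,
    fun hF => (klfs_fst3_h5_iff (by linarith) hμ₂ M he hF).not.2 (by linarith)⟩
  · rw [he]
    have h := klfs_fst4_ckHolderNormLE μ 2
    refine h.mono ?_
    rw [abs_of_neg (by linarith [hμ.2])]
    norm_num
    linarith [hμ.1]
  · rw [hv]
    exact (klfs_ckHolderNormLE_const 2 0 (U : ℂ)).mono (by rwa [Complex.norm_real, Real.norm_eq_abs])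
  · rw [he] at hp ⊢
    exact lt_of_lt_of_le (by norm_num) (hG.le_norm_gradient p hp)
  · rw [he] at hp ht ⊢
    change (0.0443 : ℝ) * ‖t‖ ^ 2 ≤ FermiRG.hessQuad (fun q : Momentum => squareDispersion 1 0 q - μ) p t
    rw [real_inner_comm] at ht
    exact hG.le_hessQuad p hp t ht

/-- **BGM 2003 on `[-0.5725, -0.1775]` with the window-of-record shell width `e₀ = 0.08`** (`μ ± e₀ ∈ [-0.6525, -0.0975] ⊂
(-4, 0)`): §1.2's `DispersionHyp`, the lattice model class `LatticeModelHyp` (any finitely supported pair potential), and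
Lemma 3.1 (4.3) sector counting for the Hubbard band. [folklore] -/
theorem klfs_cwin_bgm2003 {μ : ℝ} (hμ : μ ∈ Icc (-0.5725 : ℝ) (-0.1775)) :
    FermiRG.BGM2003.DispersionHyp sqDispersion μ 0.08 (fun θ e => bandFermiRadius (μ + e) θ) ∧
    (∀ (v : Fin 2 → Fin 2 → Literature.Probability.LatticeModels.Site 2 → ℝ), (∀ σ σ' : Fin 2, (Function.support (v σ σ')).Finite) →
      FermiRG.BGM2003.LatticeModelHyp (fun k => sqDispersion k + 4) (μ + 4) 0.08
        (fun θ e => bandFermiRadius (μ + e) θ) v) ∧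
    (∃ c : ℝ, 0 < c ∧ ∀ (n n' : ℕ), n ≤ n' →
      (∀ (L : ℕ) (i₁ : Fin L) (ω₁ : ℕ) (ωt : Fin L → ℕ), 4 ≤ L → ω₁ < sectorCount n' →
          (∀ i, ωt i < sectorCount n) →
          (Nat.card (FermiRG.BGM2003.sectorStrings (fun ϑ e' => bandFermiRadius (μ + e') ϑ) 0.08 n n' L i₁ ω₁ ωt) : ℝ) ≤
            c ^ L * (2 : ℝ) ^ ((n' - n) * (L - 3))) ∧
      (∀ (i₁ : Fin 2) (ω₁ : ℕ) (ωt : Fin 2 → ℕ), ω₁ < sectorCount n' →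
          (∀ i, ωt i < sectorCount n) →
          (Nat.card (FermiRG.BGM2003.sectorStrings (fun ϑ e' => bandFermiRadius (μ + e') ϑ) 0.08 n n' 2 i₁ ω₁ ωt) : ℝ) ≤
            c)) :=
  ⟨klfs_bgm2003_dispersionHyp (by norm_num) (by linarith [hμ.1]) (by linarith [hμ.2]),
    fun v hv => klfs_bgm2003_latticeModelHyp_of_finite (by norm_num) (by linarith [hμ.1]) (by linarith [hμ.2]) v hv,
    klfs_bgm2003_sectorCounting_hubbard (by norm_num) (by linarith [hμ.1]) (by linarith [hμ.2])⟩

/-! ### §3 Radial transversality and the SHARP bundle with numbers -/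

/-- `0.4118 ≤ s_* = min(s_a, s_b) ≤ s_b ≤ 0.4119` for `(a, b) = (-0.5725, -0.1775)` (`s_μ = √(-μ(4+μ))/2`; `s_a ≈ 0.70`).
[folklore] -/
theorem klfs_numZ_levelSin_min :
    (0.4118 : ℝ) ≤ min (Real.sqrt (-(-0.5725 : ℝ) * (4 + -0.5725)) / 2) (Real.sqrt (-(-0.1775 : ℝ) * (4 + -0.1775)) / 2) ∧
    min (Real.sqrt (-(-0.5725 : ℝ) * (4 + -0.5725)) / 2) (Real.sqrt (-(-0.1775 : ℝ) * (4 + -0.1775)) / 2) ≤ 0.4119 := by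
  have ha : (0.7 : ℝ) ≤ Real.sqrt (-(-0.5725 : ℝ) * (4 + -0.5725)) / 2 := by
    rw [le_div_iff₀ (by norm_num : (0:ℝ) < 2), Real.le_sqrt (by norm_num) (by norm_num)]; norm_num
  have hb : (0.4118 : ℝ) ≤ Real.sqrt (-(-0.1775 : ℝ) * (4 + -0.1775)) / 2 := by
    rw [le_div_iff₀ (by norm_num : (0:ℝ) < 2), Real.le_sqrt (by norm_num) (by norm_num)]; norm_num
  have hb' : Real.sqrt (-(-0.1775 : ℝ) * (4 + -0.1775)) / 2 ≤ 0.4119 := by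
    rw [div_le_iff₀ (by norm_num : (0:ℝ) < 2), Real.sqrt_le_left (by norm_num)]; norm_num
  exact ⟨le_min (by linarith) hb, (min_le_right _ _).trans hb'⟩

/-- `0.0885 ≤ min(n_a, n_b)` for `(a, b) = (-0.5725, -0.1775)` (`n_μ = (-μ/2)(1 - μ²/16)`; `n_a = 0.2804`, the minimum is
`n_b = 0.08858`). [folklore] -/
theorem klfs_numZ_levelN_min_ge :
    (0.0885 : ℝ) ≤ min (-(-0.5725 : ℝ) / 2 * (1 - (-0.5725 : ℝ) ^ 2 / 16)) (-(-0.1775 : ℝ) / 2 * (1 - (-0.1775 : ℝ) ^ 2 / 16)) :=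
  le_min (by norm_num) (by norm_num)

/-- **`∂ₜF ≥ 0.8236` on `[-0.5725, -0.1775]`** (`= 2 s_b`, the exact radial transversality of `…SharpTransversal.lean`;
`sin(√2 d_a) ≥ 0.585` and `sin K_b = s_b ≥ 0.4118`). [folklore] -/
theorem klfs_cwin_rayDispersionDt_ge {μ : ℝ} (hμ : μ ∈ Icc (-0.5725 : ℝ) (-0.1775)) (θ : ℝ) :
    (0.8236 : ℝ) ≤ rayDispersionDt θ (bandFermiRadius μ θ) := by
  have h := klfs_rayDispersionDt_ge_range (a := -0.5725) (b := -0.1775) (by norm_num) (by norm_num) (by norm_num) hμ θ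
  have hs : (0.4118 : ℝ) ≤ Real.sin (umklappRadius (-0.1775)) := by
    rw [klfs_sin_umklappRadius (by norm_num) (by norm_num), le_div_iff₀ (by norm_num : (0:ℝ) < 2),
      Real.le_sqrt (by norm_num) (by norm_num)]
    norm_num
  have hp : (0.585 : ℝ) ≤ Real.sin (Real.sqrt 2 * Real.arccos (-(-0.5725 : ℝ) / 4)) :=
    klfs_num_sin_sqrt_two_mul_ge (by linarith [klfs_numX_arccos_da_ge]) klfs_numX_arccos_da_le
  have hmin : (0.4118 : ℝ) ≤ min (Real.sin (Real.sqrt 2 * Real.arccos (-(-0.5725 : ℝ) / 4)))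
      (Real.sin (umklappRadius (-0.1775))) := le_min (by linarith) hs
  linarith

/-- **The SHARP bundle on the certificate's form-(A) window `μ ∈ [-0.5725, -0.1775]` (`δ ∈ [0.10, 0.25]`) with its constants as
numbers and the exact transversality constant**: a `BandBounds (-0.5725) (-0.1775)` with `umin ≥ 2.018`, `smax ≤ 3.85`, `A2 ≤ 33.2`,
`hmin ≥ 0.183`, `amin ≥ 0.0633`, `rhomin ≥ 0.4118`, `cmax ≤ 0.694`, `Dtmin ≥ 0.8236`, **`C_g ≤ 102`**, `Dcell ≤ 3.14` (closed-form
sharp values `2.0183, 3.8426, 33.04, 0.1842, 0.06339, 0.41185, 0.69347, 0.82371, 101.3, 3.135`, certified kit j258297; vs the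
window of record `[-0.4275, -0.1775]`: `C_g` 96.75 → 101.3, `h_min` 0.192 → 0.184, all `b`-end constants unchanged; vs the full
extended window `[-0.5725, -0.075]`: `C_g` 553 → 101). [folklore] -/
theorem klfs_cwin_sharpBandBounds :
    ∃ B : BandBounds (-0.5725) (-0.1775),
      2.018 ≤ B.umin ∧ B.smax ≤ 3.85 ∧ B.A2 ≤ 33.2 ∧ 0.183 ≤ B.hmin ∧ 0.0633 ≤ B.amin ∧ 0.4118 ≤ B.rhomin ∧
      B.cmax ≤ 0.694 ∧ 0.8236 ≤ B.Dtmin ∧ B.Cg ≤ 102 ∧ B.Dcell ≤ 3.14 := by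
  obtain ⟨B₀, hu, hs, hA, hh, ham, hr, hc, -⟩ :=
    klfs_exists_sharpBandBounds (a := -0.5725) (b := -0.1775) (by norm_num) (by norm_num) (by norm_num)
  obtain ⟨h2l, h2u⟩ := klfs_num_sqrt_two
  have hd := klfs_numX_arccos_da_ge
  have hK := klfs_numD_umklappRadius_b_le
  have hK0 : 0 < umklappRadius (-0.1775) := umklappRadius_pos (by norm_num)
  obtain ⟨hsl, -⟩ := klfs_numZ_levelSin_min
  have hκ := klfs_numD_kappa_b_ge
  have hn := klfs_numZ_levelN_min_ge
  have hsinc := klfs_numX_sinc_da_le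
  have hsinc0 := klfs_numX_sinc_da_pos
  -- the seven fields kept from the closed-form bundle
  have e_umin : 2.018 ≤ B₀.umin := by
    rw [hu]
    calc (2.018 : ℝ) ≤ 1.41421 * 1.427 := by norm_num
      _ ≤ Real.sqrt 2 * Real.arccos (-(-0.5725 : ℝ) / 4) := mul_le_mul h2l hd (by norm_num) (Real.sqrt_nonneg 2)
  have e_smax : B₀.smax ≤ 3.85 := by
    rw [hs]
    calc Real.sqrt 2 * umklappRadius (-0.1775) ≤ 1.41422 * 2.72 := mul_le_mul h2u hK hK0.le (by norm_num)
      _ ≤ 3.85 := by norm_num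
  have e_A2 : B₀.A2 ≤ 33.2 := by
    rw [hA]
    have h1 : umklappRadius (-0.1775) ^ 2 /
        min (Real.sqrt (-(-0.5725 : ℝ) * (4 + -0.5725)) / 2) (Real.sqrt (-(-0.1775 : ℝ) * (4 + -0.1775)) / 2) ≤
        2.72 ^ 2 / 0.4118 :=
      (div_le_div_of_nonneg_right (pow_le_pow_left₀ hK0.le hK 2) (by linarith)).trans
        (div_le_div_of_nonneg_left (by norm_num) (by norm_num) hsl)
    have h3 : 0 ≤ umklappRadius (-0.1775) ^ 2 /
        min (Real.sqrt (-(-0.5725 : ℝ) * (4 + -0.5725)) / 2) (Real.sqrt (-(-0.1775 : ℝ) * (4 + -0.1775)) / 2) +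
        2 * umklappRadius (-0.1775) := by positivity
    calc Real.sqrt 2 * (umklappRadius (-0.1775) ^ 2 /
          min (Real.sqrt (-(-0.5725 : ℝ) * (4 + -0.5725)) / 2) (Real.sqrt (-(-0.1775 : ℝ) * (4 + -0.1775)) / 2) +
          2 * umklappRadius (-0.1775))
        ≤ 1.41422 * (2.72 ^ 2 / 0.4118 + 2 * 2.72) := mul_le_mul h2u (by linarith) h3 (by norm_num)
      _ ≤ 33.2 := by norm_num
  have e_hmin : 0.183 ≤ B₀.hmin := by
    rw [hh, le_div_iff₀ (pow_pos hsinc0 2)]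
    have h1 : (Real.sin (Real.arccos (-(-0.5725 : ℝ) / 4)) / Real.arccos (-(-0.5725 : ℝ) / 4)) ^ 2 ≤ 0.694 ^ 2 :=
      pow_le_pow_left₀ hsinc0.le hsinc 2
    calc (0.183 : ℝ) * (Real.sin (Real.arccos (-(-0.5725 : ℝ) / 4)) / Real.arccos (-(-0.5725 : ℝ) / 4)) ^ 2
        ≤ 0.183 * 0.694 ^ 2 := mul_le_mul_of_nonneg_left h1 (by norm_num)
      _ ≤ 0.0885 := by norm_num
      _ ≤ _ := hn
  have e_amin : 0.0633 ≤ B₀.amin := by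
    rw [ham]
    calc (0.0633 : ℝ) ≤ 0.0314 * (1.41421 * 1.427) := by norm_num
      _ ≤ _ := mul_le_mul hκ (mul_le_mul h2l hd (by norm_num) (Real.sqrt_nonneg 2)) (by norm_num) (by linarith)
  have e_rhomin : 0.4118 ≤ B₀.rhomin := by rw [hr]; exact hsl
  have e_cmax : B₀.cmax ≤ 0.694 := by rw [hc]; exact hsinc
  -- the exact transversality constant replaces the closed-form `Dtmin`
  have hDt : ∀ μ ∈ Icc (-0.5725 : ℝ) (-0.1775), ∀ θ : ℝ, (0.8236 : ℝ) ≤ rayDispersionDt θ (bandFermiRadius μ θ) :=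
    fun μ hμ θ => klfs_cwin_rayDispersionDt_ge hμ θ
  refine ⟨{ B₀ with Dtmin := 0.8236, Dtmin_pos := by norm_num, Dt_ge := hDt }, e_umin, e_smax, e_A2, e_hmin, e_amin,
    e_rhomin, e_cmax, le_rfl, ?_, ?_⟩
  · show π * B₀.cmax / (2 * B₀.amin * B₀.rhomin ^ 2) ≤ 102
    have hπ := Real.pi_lt_d4
    have hBa : 0 < B₀.amin := B₀.amin_pos
    have hBr : 0 < B₀.rhomin := B₀.rhomin_pos
    rw [div_le_iff₀ (by positivity)]
    have h1 : π * B₀.cmax ≤ 3.1416 * 0.694 := mul_le_mul hπ.le e_cmax B₀.cmax_pos.le (by norm_num)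
    have h2 : (0.0633 : ℝ) * 0.4118 ^ 2 ≤ B₀.amin * B₀.rhomin ^ 2 :=
      mul_le_mul e_amin (pow_le_pow_left₀ (by norm_num) e_rhomin 2) (by norm_num) hBa.le
    have h3 : 102 * (2 * B₀.amin * B₀.rhomin ^ 2) = 204 * (B₀.amin * B₀.rhomin ^ 2) := by ring
    rw [h3]
    linarith
  · show 1 / (0.8236 : ℝ) + B₀.smax / 2 ≤ 3.14
    have : (1 : ℝ) / 0.8236 ≤ 1.2142 := by norm_num
    linarith

end Summit.HubbardSuperconductivity.HubbardSuperconductivity.Theorems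

end
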